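/-
Copyright (c) 2026. All rights reserved.
Released under Apache 2.0 license as described in the file LICENSE.
-/
import Summits.HubbardSuperconductivity.HubbardLadder.Bounds.SectorCommutatorRateSharp
import Summits.HubbardSuperconductivity.HubbardLadder.Bounds.SectorFourierGridNonvanishing
import Summits.HubbardSuperconductivity.HubbardLadder.Bounds.SectorGrandSumLowerBound
import Summits.HubbardSuperconductivity.HubbardLadder.Bounds.SectorCentredFugacityWindow
import HarnessLib

/-!
# Theorem 13_N assembled: numeric hypotheses only (bounds.tex §13, D5(d))

HONEST FRAMING: ladder R1–R4 with certified numbers; no claim on H/H₀. These are bounds for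
MODEL CLASSES (the typed REPULSIVE `t–t'` Hubbard torus with a flux twist), no materials claim.

This part COMPOSES the parts of LEAN FILING REQUEST #211 into one statement whose hypotheses
are INEQUALITIES BETWEEN REAL NUMBERS built from `(β, t', U)`, the arc / Kotecký–Preiss data
`(c₀, u₀, R, a, δ, F, r, r₁)` and the sector data `(N, K_w, L)` — no fugacity `s`, no Fourier
grid `M`, no variance / mean / atomic-zero / walk hypothesis is left:

* the base fugacity is CENTRED internally (`gcMean = N`, #211.7 `exists_gcMean_eq`, so `K₀ = 0`);
* the Fourier grid is an odd `M > |Orb Λ_L|` (#211.20 `exists_odd_gt`, `tt_hz_of_odd_repulsive`: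
  the hypothesis `hz` holds for `β > 0`, `U ≥ 0`);
* the variance input is #211.11 (`V = (1 + 4a/r²)|Λ_L|`, `K = 2√V`, so `1 - V/K² = 3/4`);
* the walk input is #211.18/#211.19 with the sharp rate `r♯ = 4 + 4|t'| + |U|`; the transfer
  walk constant does NOT depend on the fugacity (`transferWalkConstant_eq_at_zero`: the factor
  `e^{s}` cancels between the two envelopes), so it is evaluated at `s = 0`;
* the off-arc term is bounded by #211.21 (`Ξ(s) ≥ z^{|Λ|}e^{-a|Λ|}`) and its rate
  `κ = offArcRate c₀ u₀ (βU) s` — which depends on `s` ONLY through the atomic density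
  `n_at(βU,s)` — is bounded BELOW on the density window `|n_at - N/|Λ_L|| ≤ 2a/r` of #211.22 by
  the explicit `offArcRateFloor c₀ u₀ (N/|Λ_L|) (2a/r)` and ABOVE by `offArcRateCeil c₀ u₀`
  (used to make the off-arc fixed-point hypothesis `hF` fugacity-free).

RESULT (`norm_ttSectorZ_twist_sub_le_assembled`): for `L ≥ 3`, `β > 0`, `U ≥ 0`, every `θ`,
`‖Z_N(θ) - Z_N(0)‖ ≤ (4/3)(4√V + 1) C₀^{2K_w} ((e^{2aL²e^{-δL}} - 1) + 2e^{-η|Λ_L|}) Re Z_N(0)`,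
`η = e^{κ₋} + κ₋ - F - a`, `κ₋ = offArcRateFloor c₀ u₀ (N/|Λ_L|) (2a/r)`,
`C₀ = transferWalkConstant n N K_w (β n r♯) 0`, under: the arc/floor conditions, the one-site
Kotecký–Preiss smallness `16 S e^{2S}(R e^{a+δ} + a)² ≤ a` (`S = β(1+|t'|)`), the off-arc
fixed point `e^{κ̄} + 16 S e^{2S} F² ≤ F`, radii `0 < r < r₁ ≤ π/4`, `c₀ ≤ cos r₁`, and the window
arithmetic `8√V + 2 ≤ K_w ≤ N`, `N + K_w ≤ |Orb Λ_L|`.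

QUANTITATIVE CAVEAT (stated, not hidden; bounds.tex §13 'Honest size, revised'): the walk factor
`C₀^{2K_w}` grows like `e^{c β r♯ √(1+4a/r²) L}` while the numerator decays like `e^{-δL}`; the
bound is small only in a HIGH-TEMPERATURE window where `δ(β)` beats that rate, and NO instance
row is certified here (zero kit; successor work, together with the `≈ 4×` window bookkeeping).
No numerics, no `native_decide`; standard axioms only. References: R. Kotecký, D. Preiss, Comm.
Math. Phys. 103 (1986) 491 [KoteckyPreiss1986]; D. Ueltschi, Analyticity in Hubbard models,
J. Stat. Phys. 95 (1999) 693, §2.3 Prop. 2.2 [Ueltschi1999]; bounds.tex §13.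
-/

noncomputable section

namespace Summit.HubbardSuperconductivity.HubbardLadder.Bounds

open Matrix Finset Complex
open Literature.MathematicalPhysics.QuantumLattice
open scoped ComplexOrder

/-! ### The off-arc rate in density coordinates -/

/-- The off-arc rate ceiling `κ̄(c₀,u₀) = (1 - c₀) / ((1 + e^{u₀})(1 + e^{u₀/2}))`.
[programme definition: bounds.tex §13, D5(d)] -/
def offArcRateCeil (c₀ u₀ : ℝ) : ℝ := (1 - c₀) / ((1 + Real.exp u₀) * (1 + Real.exp (u₀ / 2)))

/-- The off-arc rate floor on the density window `|n - ρ| ≤ η`: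
`κ₋(c₀,u₀,ρ,η) = (1 - c₀)(1 - (|1 - ρ| + η)²) / ((1 + e^{u₀})(1 + e^{u₀/2}))`.
[programme definition: bounds.tex §13, D5(d)] -/
def offArcRateFloor (c₀ u₀ ρ η : ℝ) : ℝ :=
  (1 - c₀) * (1 - (|1 - ρ| + η) ^ 2) / ((1 + Real.exp u₀) * (1 + Real.exp (u₀ / 2)))

/-- `κ(c₀,u₀,v,s) ≤ κ̄(c₀,u₀)` for `c₀ ≤ 1` (`n(2-n) = 1 - (1-n)² ≤ 1`). [this file] -/
theorem offArcRate_le_ceil {c₀ : ℝ} (hc1 : c₀ ≤ 1) (u₀ v s : ℝ) :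
    offArcRate c₀ u₀ v s ≤ offArcRateCeil c₀ u₀ := by
  unfold offArcRate offArcRateCeil
  refine div_le_div_of_nonneg_right ?_ (by positivity)
  have h : atomicDensity v s * (2 - atomicDensity v s) ≤ 1 := by
    nlinarith [sq_nonneg (1 - atomicDensity v s)]
  nlinarith

/-- `κ₋(c₀,u₀,ρ,η) ≤ κ(c₀,u₀,v,s)` whenever `|n_at(v,s) - ρ| ≤ η` and `c₀ ≤ 1`
(`|1 - n| ≤ |1 - ρ| + η`, `n(2-n) = 1 - (1-n)²`). [this file] -/
theorem offArcRateFloor_le {c₀ : ℝ} (hc1 : c₀ ≤ 1) (u₀ : ℝ) {v s ρ η : ℝ}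
    (h : |atomicDensity v s - ρ| ≤ η) : offArcRateFloor c₀ u₀ ρ η ≤ offArcRate c₀ u₀ v s := by
  unfold offArcRate offArcRateFloor
  refine div_le_div_of_nonneg_right (mul_le_mul_of_nonneg_left ?_ (by linarith)) (by positivity)
  have hm : |1 - atomicDensity v s| ≤ |1 - ρ| + η :=
    calc |1 - atomicDensity v s| = |(1 - ρ) - (atomicDensity v s - ρ)| := by ring_nf
      _ ≤ |1 - ρ| + |atomicDensity v s - ρ| := abs_sub _ _
      _ ≤ |1 - ρ| + η := by linarith
  have hsq : (1 - atomicDensity v s) ^ 2 ≤ (|1 - ρ| + η) ^ 2 := by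
    rw [← sq_abs (1 - atomicDensity v s)]
    exact pow_le_pow_left₀ (abs_nonneg _) hm 2
  nlinarith

/-! ### The transfer walk constant does not depend on the fugacity -/

/-- `transferWalkConstant n N K_w b s = transferWalkConstant n N K_w b 0`: the factor `e^{s}`
of the two transfer envelopes cancels in their quotient. [this file] -/
theorem transferWalkConstant_eq_at_zero (n N Kw : ℕ) (b s : ℝ) :
    transferWalkConstant n N Kw b s = transferWalkConstant n N Kw b 0 := by
  have h1 : ∀ k : ℕ, transferAp n b s k = Real.exp s * transferAp n b 0 k := fun k => by
    unfold transferAp; rw [Real.exp_zero]; ring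
  have h2 : ∀ k : ℕ, transferAm n b s k = Real.exp s * transferAm n b 0 k := fun k => by
    unfold transferAm; rw [Real.exp_zero]; ring
  unfold transferWalkConstant
  rw [h1, h2, mul_div_mul_left _ _ (Real.exp_pos s).ne']

/-! ### Theorem 13_N assembled -/

section Torus

variable {L : ℕ} [NeZero L]

/-- **THEOREM 13_N ASSEMBLED (numeric hypotheses only; bounds.tex §13, D5(d)).** Let `L ≥ 3`,
`β > 0`, `U ≥ 0`, `t', θ` real; arc/floor data `0 ≤ c₀ ≤ cos r₁`, `|βU| ≤ u₀`, `R > 0` with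
`R²(1 - (1-c₀)/2 - (1-c₀²)/(1+e^{-u₀/2})²) ≥ 1`; `a, δ > 0` with `16 S e^{2S}(R e^{a+δ} + a)² ≤ a`
(`S = β(1+|t'|)`); `F` with `e^{κ̄} + 16 S e^{2S} F² ≤ F` (`κ̄ = offArcRateCeil c₀ u₀`); radii
`0 < r < r₁ ≤ π/4`; window arithmetic `8√V + 2 ≤ K_w ≤ N`, `N + K_w ≤ n` with
`V = (1 + 4a/r²)|Λ_L|`, `n = |Orb Λ_L|`. Then, for the block `#s = N` of `H^{tt'}_L(θ)`,
`‖Z_N(θ) - Z_N(0)‖ ≤ (4/3)(4√V + 1) C₀^{2K_w} ((e^{2aL²e^{-δL}} - 1) + 2e^{-η|Λ_L|}) Re Z_N(0)`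
with `C₀ = transferWalkConstant n N K_w (β n r♯) 0` (`r♯ = ttCommRateSharp t' U`),
`η = e^{κ₋} + κ₋ - F - a`, `κ₋ = offArcRateFloor c₀ u₀ (N/|Λ_L|) (2a/r)`. Every model input of
Theorem 13_N (#211.8) is DISCHARGED: centring (#211.7), variance (#211.11), walk (#211.18/.19),
atomic non-vanishing (#211.20), off-arc denominator (#211.21), centred density (#211.22).
[programme: bounds.tex §13 Theorem 13_N, D5(d); this file] -/
theorem norm_ttSectorZ_twist_sub_le_assembled (hL : 3 ≤ L) {β : ℝ} (hβ : 0 < β) {U : ℝ}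
    (hU : 0 ≤ U) (t' θ : ℝ) {N Kw : ℕ} {c₀ u₀ R a δ F r r₁ : ℝ} (hc₀ : 0 ≤ c₀)
    (hv : |β * U| ≤ u₀) (hR : 0 < R)
    (hfloor : 1 ≤ R ^ 2 * (1 - (1 - c₀) / 2 - (1 - c₀ ^ 2) / (1 + Real.exp (-(u₀ / 2))) ^ 2))
    (ha : 0 < a) (hδ : 0 < δ)
    (hsmall : 16 * (|β| * (1 + |t'|)) * Real.exp (2 * (|β| * (1 + |t'|))) *
      (R * Real.exp (a + δ) + a) ^ 2 ≤ a)
    (hF : Real.exp (offArcRateCeil c₀ u₀) +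
      16 * (|β| * (1 + |t'|)) * Real.exp (2 * (|β| * (1 + |t'|))) * F ^ 2 ≤ F)
    (hr : 0 < r) (hrr₁ : r < r₁) (hr₁ : r₁ ≤ Real.pi / 4) (hc₀r : c₀ ≤ Real.cos r₁)
    (hKw : 8 * Real.sqrt ((1 + 4 * a / r ^ 2) * Fintype.card (FermionTorus 2 L)) + 2 ≤ Kw)
    (hKwN : Kw ≤ N) (hNKw : N + Kw ≤ Fintype.card (Orb (FermionTorus 2 L))) :
    ‖ttSectorZ L β t' U θ N - ttSectorZ L β t' U 0 N‖ ≤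
      4 / 3 * (4 * Real.sqrt ((1 + 4 * a / r ^ 2) * Fintype.card (FermionTorus 2 L)) + 1) *
          transferWalkConstant (Fintype.card (Orb (FermionTorus 2 L))) N Kw
              (β * (Fintype.card (Orb (FermionTorus 2 L)) * ttCommRateSharp t' U)) 0 ^ (2 * Kw) *
        ((Real.exp (2 * a * (L : ℝ) ^ 2 * Real.exp (-(δ * L))) - 1) +
          2 * Real.exp (-((Real.exp (offArcRateFloor c₀ u₀
              (N / Fintype.card (FermionTorus 2 L)) (2 * a / r)) +
            offArcRateFloor c₀ u₀ (N / Fintype.card (FermionTorus 2 L)) (2 * a / r) - F - a) *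
              Fintype.card (FermionTorus 2 L)))) *
        (ttSectorZ L β t' U 0 N).re := by
  set V : ℝ := (1 + 4 * a / r ^ 2) * Fintype.card (FermionTorus 2 L) with hVdef
  set κf : ℝ := offArcRateFloor c₀ u₀ (N / Fintype.card (FermionTorus 2 L)) (2 * a / r) with hκdef
  have hw : ∀ k ≤ Fintype.card (Orb (FermionTorus 2 L)), 0 < ttSectorWeight L β t' U k :=
    fun k hk => ttSectorWeight_pos β t' U hk
  have hc1 : c₀ ≤ 1 := hc₀r.trans (Real.cos_le_one r₁)
  -- the window arithmetic in `ℕ` and `ℝ`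
  have hKw2 : 2 ≤ Kw := by
    have h : (2 : ℝ) ≤ Kw := by
      linarith [Real.sqrt_nonneg ((1 + 4 * a / r ^ 2) * Fintype.card (FermionTorus 2 L))]
    exact_mod_cast h
  have hN0 : (0 : ℝ) < N := by
    have : 0 < N := by omega
    exact_mod_cast this
  have hNn : (N : ℝ) < Fintype.card (Orb (FermionTorus 2 L)) := by
    have : N < Fintype.card (Orb (FermionTorus 2 L)) := by omega
    exact_mod_cast this
  -- centring (#211.7): `gcMean = N` exactly, so `K₀ = 0`
  obtain ⟨s, hs⟩ := exists_gcMean_eq hw hN0 hNn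
  have hm : |gcMean (ttSectorWeight L β t' U) (Fintype.card (Orb (FermionTorus 2 L))) s - N| ≤
      0 := by
    rw [hs, sub_self, abs_zero]
  -- the odd Fourier grid (#211.20)
  obtain ⟨M, hMo, hnM⟩ := exists_odd_gt (Fintype.card (Orb (FermionTorus 2 L)))
  have hNM : N < M := by omega
  have hz := tt_hz_of_odd_repulsive hβ hU s hMo
  -- the variance (#211.11): `gcVar ≤ V`, `K = 2√V`
  have hV : gcVar (ttSectorWeight L β t' U) (Fintype.card (Orb (FermionTorus 2 L))) s ≤ V :=
    gcVar_ttSectorWeight_le hL hβ.ne' t' U s hc₀ hv hR hfloor ha hδ hsmall hr hrr₁ hr₁ hc₀r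
  have hΛ1 : (1 : ℝ) ≤ Fintype.card (FermionTorus 2 L) := by
    have : 0 < Fintype.card (FermionTorus 2 L) := Fintype.card_pos
    exact_mod_cast this
  have hV1 : 1 ≤ V := by
    have h4 : 0 ≤ 4 * a / r ^ 2 := by positivity
    rw [hVdef]
    nlinarith
  have hV0 : 0 ≤ V := by linarith
  have hK : (1 : ℝ) ≤ 2 * Real.sqrt V := by
    have h1 : (1 : ℝ) ≤ Real.sqrt V := (Real.le_sqrt' one_pos).2 (by simpa using hV1)
    linarith
  have hVK : V < (2 * Real.sqrt V) ^ 2 := by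
    rw [mul_pow, Real.sq_sqrt hV0]; linarith
  have hVK' : 1 - V / (2 * Real.sqrt V) ^ 2 = 3 / 4 := by
    rw [mul_pow, Real.sq_sqrt hV0]
    field_simp
    ring
  have hKw' : (0 : ℝ) + 4 * (2 * Real.sqrt V) + 2 ≤ Kw := by rw [hVdef]; linarith
  -- the off-arc fixed point at `s` from the fugacity-free one
  have hFs : Real.exp (offArcRate c₀ u₀ (β * U) s) +
      16 * (|β| * (1 + |t'|)) * Real.exp (2 * (|β| * (1 + |t'|))) * F ^ 2 ≤ F :=
    le_trans (by linarith [Real.exp_le_exp.2 (offArcRate_le_ceil hc1 u₀ (β * U) s)]) hF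
  -- Theorem 13_N with the sharp walk constant (#211.19)
  have h := norm_ttSectorZ_twist_sub_le_sharp hL hβ t' U θ hnM hNM s hz hc₀ hc1 hv hR hfloor
    ha hδ hsmall hFs hK hV hVK hm hKw' hKwN hNKw
  -- the off-arc term (#211.21) on the density window (#211.22)
  have hn := abs_atomicDensity_sub_le_of_gcMean_eq hL hβ.ne' t' U s hc₀ hv hR hfloor ha hδ
    hsmall hr hrr₁ hr₁ hc₀r hs
  have hκ : κf ≤ offArcRate c₀ u₀ (β * U) s := offArcRateFloor_le hc1 u₀ hn
  have hη : Real.exp κf + κf - F - a ≤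
      Real.exp (offArcRate c₀ u₀ (β * U) s) + offArcRate c₀ u₀ (β * U) s - F - a := by
    linarith [Real.exp_le_exp.2 hκ]
  have hoff := offArcTerm_le_exp_neg hL hβ.ne' t' U s hc₀ hc1 hv hR hfloor ha hδ hsmall hη
  -- constants: the walk constant at `s = 0`, `1 - V/K² = 3/4`, signs
  rw [transferWalkConstant_eq_at_zero, hVK'] at h
  have hKw1 : 1 ≤ Kw := by omega
  have hC := transferWalkConstant_pos (n := Fintype.card (Orb (FermionTorus 2 L)))
    (β * (Fintype.card (Orb (FermionTorus 2 L)) * ttCommRateSharp t' U)) (0 : ℝ) hKw1 hNKw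
  have hre : 0 ≤ (ttSectorZ L β t' U 0 N).re := (ttSectorZ_pos β t' U 0 (by omega)).1.le
  have hpre : 0 ≤ 4 / 3 * (4 * Real.sqrt V + 1) *
      transferWalkConstant (Fintype.card (Orb (FermionTorus 2 L))) N Kw
        (β * (Fintype.card (Orb (FermionTorus 2 L)) * ttCommRateSharp t' U)) 0 ^ (2 * Kw) := by
    positivity
  refine h.trans ?_
  rw [show (2 * (2 * Real.sqrt V) + 1) *
      transferWalkConstant (Fintype.card (Orb (FermionTorus 2 L))) N Kw
        (β * (Fintype.card (Orb (FermionTorus 2 L)) * ttCommRateSharp t' U)) 0 ^ (2 * Kw) /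
      (3 / 4) = 4 / 3 * (4 * Real.sqrt V + 1) *
      transferWalkConstant (Fintype.card (Orb (FermionTorus 2 L))) N Kw
        (β * (Fintype.card (Orb (FermionTorus 2 L)) * ttCommRateSharp t' U)) 0 ^ (2 * Kw) by ring]
  exact mul_le_mul_of_nonneg_right (mul_le_mul_of_nonneg_left (add_le_add le_rfl hoff) hpre) hre

end Torus

end Summit.HubbardSuperconductivity.HubbardLadder.Bounds
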